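import Mathlib
import Summits.KontsevichZagierPeriods.Zeta5Search.WedgeDictionaryInstances
import HarnessLib

/-!
# Bailey's `W(E₇)` reflections on the Brown–Zudilin dual family: typed maps, kernel instances of the
# deep ↦ shallow law, and the law as a conjecture (cell `pub-zeta5`, fam-rv seat)

HONEST FRAMING: systematic search; no irrationality claim unless certified.
(Filed for `fam-rv` by P2; docstrings added to 18 helper lemmas, statements and proofs byte-identical otherwise.)  THIS IS NOT LITERATURE: everything
here is OUR work (Summit side); `BaileyShallowLaw` is an internally minted conjecture (exhaustively verified for
`b₀ ≤ 30` outside Lean, two independent exact implementations; `run/shared/lean/pub/pub-zeta5/families/rv/FAMILY.md`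
§3.4, §4), tagged `@[conjecture]`; the instances below are kernel arithmetic.

Background (FAMILY.md §3.3).  In the coordinates `x = (b₀/2; b₁−b₀/2, …, b₇−b₀/2)` the 28 Brown–Zudilin forms are
`x₀+x_k` and `−(x_k+x_l)`, one half of the 56 weights of the minuscule representation of `E₇`; the Weyl group
`W(E₇) ⊃ S₈ ⊃ S₇` is generated over `S₇` by the BAILEY MAPS
`T_S : (b₀; b_S, b_rest) ↦ (b₀+Δ; b_S+Δ, b_rest)`, `Δ = b₀ − Σ_{s∈S} b_s`, `S ⊂ {1,…,7}`, `|S| = 3`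
— the parameter change of Bailey's four-term transformation of 2-balanced very-well-poised `₉F₈(1)`'s
(Gasper–Rahman (2.12.9) at `q → 1`; the balanced slice is `d(b) = 3b₀ − Σ b_j = −1`).

Contents:
* `baileyDelta`, `baileyT i j k` (the map `T_{{i,j,k}}` on `b : ℕ → ℤ`), `baileyT_baileyT` (involution),
  `dOf_baileyT` (it preserves the excess `d(b)` = `WedgeDictionary.dOf`, for `1 ≤ i < j < k ≤ 7`).
* KERNEL INSTANCES of the deep ↦ shallow law at the smallest points of both slices:
  `d = −1`: `b = (2;1⁷)` has `(U,W,V) = (−2, 2, 0)` (`F̃₇ = 2ζ(3) − 2ζ(5)`, deep) and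
  `T_{567} b = (1;1,1,1,1,0,0,0)` has `(U,W,V) = (0,0,−1)` (`F̃₇ = 1 ∈ ℚ`);
  `d = 0`: `b = (2;1⁶,0)` has `(U,W,V) = (2,0,2)` (`F̃₇ = 2ζ(5) − 2`, deep) and
  `T_{456} b = (1;1,1,1,0,0,0,0)` has `(U,W,V) = (0,2,2)` (`F̃₇ = 2ζ(3) − 2`: no `ζ(5)`, `ζ(3)` survives).
  (`U, W, V` = the CANONICAL coefficients `WedgeDictionary.coeffU/W/V`, from explicit partial-fraction tables.)
* `BaileyShallowLaw` (`@[conjecture]`): for `b` in the polytope `0 ≤ 2b_j ≤ b₀` with `d(b) ∈ {−1, 0}` and any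
  Bailey image `b' = T_S b ≥ 0` with `Δ ≠ 0`: `U(b') = 0`, and `W(b') = 0` too when `d(b) = −1`.
  So no element of `W(E₇) ∖ S₇` relates two `ζ(5)`-carrying points: the arithmetic group at level 5 is `S₇`.
-/

noncomputable section

open Finset Polynomial

namespace Summit.KontsevichZagierPeriods.Zeta5Search.RVBailey

open Summit.KontsevichZagierPeriods.Zeta5Search.DualSeries
open Summit.KontsevichZagierPeriods.Zeta5Search.WedgeDictionary
open Literature.NumberTheory.Transcendental
open Literature.NumberTheory.Transcendental.BallRivoal (pfEval harm)

/-! ### The Bailey maps -/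

/-- `Δ_S(b) = b₀ − b_i − b_j − b_k`. -/
def baileyDelta (i j k : ℕ) (b : ℕ → ℤ) : ℤ := b 0 - b i - b j - b k

/-- `T_S b`: add `Δ_S(b)` to `b₀` and to `b_s`, `s ∈ S = {i,j,k}`; keep the other four. -/
def baileyT (i j k : ℕ) (b : ℕ → ℤ) : ℕ → ℤ := fun l =>
  if l = 0 ∨ l = i ∨ l = j ∨ l = k then b l + baileyDelta i j k b else b l

/-- `Δ` changes sign under the Bailey map `T_{ijk}`. -/
theorem baileyDelta_baileyT (i j k : ℕ) (b : ℕ → ℤ) :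
    baileyDelta i j k (baileyT i j k b) = -baileyDelta i j k b := by
  simp [baileyDelta, baileyT]

/-- `T_S` is an involution. -/
theorem baileyT_baileyT (i j k : ℕ) (b : ℕ → ℤ) : baileyT i j k (baileyT i j k b) = b := by
  funext l
  show (if l = 0 ∨ l = i ∨ l = j ∨ l = k then baileyT i j k b l + baileyDelta i j k (baileyT i j k b)
    else baileyT i j k b l) = b l
  rw [baileyDelta_baileyT]
  by_cases hl : l = 0 ∨ l = i ∨ l = j ∨ l = k
  · rw [if_pos hl]; simp only [baileyT, if_pos hl]; ring
  · rw [if_neg hl]; simp only [baileyT, if_neg hl]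

/-- `T_S` fixes the hyperplane `Δ_S = 0` pointwise. -/
theorem baileyT_of_delta_eq_zero (i j k : ℕ) (b : ℕ → ℤ) (h : baileyDelta i j k b = 0) :
    baileyT i j k b = b := by
  funext l
  by_cases hl : l = 0 ∨ l = i ∨ l = j ∨ l = k <;> simp [baileyT, hl, h]

/-- `T_S` preserves the excess `d(b) = 3b₀ − Σ_j b_j`. -/
theorem dOf_baileyT (i j k : ℕ) (hi : 1 ≤ i) (hij : i < j) (hjk : j < k) (hk : k ≤ 7) (b : ℕ → ℤ) :
    dOf (baileyT i j k b) = dOf b := by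
  have hi' : i ≤ 5 := by omega
  have hj' : j ≤ 6 := by omega
  interval_cases i <;> interval_cases j <;> interval_cases k <;>
    (simp only [dOf, sum_range_succ, sum_range_zero]; norm_num [baileyT, baileyDelta]; ring)

/-! ### On the two slices every Bailey map moves every polytope point and lowers `b₀`

On the Brown–Zudilin polytope `0 ≤ 2b_l ≤ b₀` the excess of a Bailey map is forced negative on the balanced slice
`d = −1` (`Δ ≤ −1`) and non-positive on `d = 0`; since `(T_S b)₀ = b₀ + Δ`, the images have strictly smaller
(resp. not larger) leading parameter.  In particular no Bailey map fixes a balanced polytope point, and the maps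
carry the polytope slices *out of* the asymptotic regime `b₀ → ∞` along rays rather than relating points of it. -/

/-- On the polytope `0 ≤ 2b_j ≤ b₀` with `d(b) = −1`, every `Δ_{ijk} ≤ −1` (`1 ≤ i < j < k ≤ 7`). -/
theorem baileyDelta_le_of_balanced (b : ℕ → ℤ) (hP : ∀ l ∈ range 7, 0 ≤ b (l + 1) ∧ 2 * b (l + 1) ≤ b 0)
    (hd : dOf b = -1) (i j k : ℕ) (hi : 1 ≤ i) (hij : i < j) (hjk : j < k) (hk : k ≤ 7) :
    baileyDelta i j k b ≤ -1 := by
  have h1 := hP 0 (by simp); have h2 := hP 1 (by simp); have h3 := hP 2 (by simp); have h4 := hP 3 (by simp)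
  have h5 := hP 4 (by simp); have h6 := hP 5 (by simp); have h7 := hP 6 (by simp)
  simp only [dOf, sum_range_succ, sum_range_zero] at hd
  norm_num at h1 h2 h3 h4 h5 h6 h7 hd
  have hi' : i ≤ 5 := by omega
  have hj' : j ≤ 6 := by omega
  interval_cases i <;> interval_cases j <;> interval_cases k <;> (simp only [baileyDelta]; omega)

/-- On the polytope with `d(b) = 0`, every `Δ_{ijk} ≤ 0` (`1 ≤ i < j < k ≤ 7`). -/
theorem baileyDelta_nonpos_of_dOf_zero (b : ℕ → ℤ) (hP : ∀ l ∈ range 7, 0 ≤ b (l + 1) ∧ 2 * b (l + 1) ≤ b 0)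
    (hd : dOf b = 0) (i j k : ℕ) (hi : 1 ≤ i) (hij : i < j) (hjk : j < k) (hk : k ≤ 7) :
    baileyDelta i j k b ≤ 0 := by
  have h1 := hP 0 (by simp); have h2 := hP 1 (by simp); have h3 := hP 2 (by simp); have h4 := hP 3 (by simp)
  have h5 := hP 4 (by simp); have h6 := hP 5 (by simp); have h7 := hP 6 (by simp)
  simp only [dOf, sum_range_succ, sum_range_zero] at hd
  norm_num at h1 h2 h3 h4 h5 h6 h7 hd
  have hi' : i ≤ 5 := by omega
  have hj' : j ≤ 6 := by omega
  interval_cases i <;> interval_cases j <;> interval_cases k <;> (simp only [baileyDelta]; omega)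

/-- The leading parameter of the image: `(T_S b)₀ = b₀ + Δ_S(b)`. -/
theorem baileyT_zero (i j k : ℕ) (b : ℕ → ℤ) : baileyT i j k b 0 = b 0 + baileyDelta i j k b := by
  simp [baileyT]

/-- On the polytope with `d(b) = −1`, the Bailey image has strictly smaller `b₀`. -/
theorem baileyT_zero_lt_of_balanced (b : ℕ → ℤ) (hP : ∀ l ∈ range 7, 0 ≤ b (l + 1) ∧ 2 * b (l + 1) ≤ b 0)
    (hd : dOf b = -1) (i j k : ℕ) (hi : 1 ≤ i) (hij : i < j) (hjk : j < k) (hk : k ≤ 7) :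
    baileyT i j k b 0 < b 0 := by
  have := baileyDelta_le_of_balanced b hP hd i j k hi hij hjk hk
  rw [baileyT_zero]; omega

/-! ### The four vectors -/

/-- `bD1 = (2; 1⁷)` (polytope, `d = −1`, deep). -/
def bD1 : ℕ → ℤ := fun l => if l = 0 then 2 else if l ≤ 7 then 1 else 0
/-- `bS1 = (1; 1,1,1,1,0,0,0) = T_{567} bD1` (shallow: `F̃₇ = 1`). -/
def bS1 : ℕ → ℤ := fun l => if l = 0 then 1 else if l ≤ 4 then 1 else 0
/-- `bD0 = (2; 1⁶, 0)` (polytope, `d = 0`, deep). -/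
def bD0 : ℕ → ℤ := fun l => if l = 0 then 2 else if l ≤ 6 then 1 else 0
/-- `bS0 = (1; 1,1,1,0,0,0,0) = T_{456} bD0` (shallow: `F̃₇ = 2ζ(3) − 2`). -/
def bS0 : ℕ → ℤ := fun l => if l = 0 then 1 else if l ≤ 3 then 1 else 0

/-- `T₅₆₇` maps the deep point `bD1` to the shallow point `bS1`. -/
theorem baileyT_bD1 : baileyT 5 6 7 bD1 = bS1 := by
  funext l
  match l with
  | 0 => simp [baileyT, baileyDelta, bD1, bS1] | 1 => simp [baileyT, bD1, bS1]
  | 2 => simp [baileyT, bD1, bS1] | 3 => simp [baileyT, bD1, bS1]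
  | 4 => simp [baileyT, bD1, bS1] | 5 => simp [baileyT, baileyDelta, bD1, bS1]
  | 6 => simp [baileyT, baileyDelta, bD1, bS1] | 7 => simp [baileyT, baileyDelta, bD1, bS1]
  | n + 8 => simp [baileyT, bD1, bS1]

/-- `T₄₅₆` maps the deep point `bD0` to the shallow point `bS0`. -/
theorem baileyT_bD0 : baileyT 4 5 6 bD0 = bS0 := by
  funext l
  match l with
  | 0 => simp [baileyT, baileyDelta, bD0, bS0] | 1 => simp [baileyT, bD0, bS0]
  | 2 => simp [baileyT, bD0, bS0] | 3 => simp [baileyT, bD0, bS0]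
  | 4 => simp [baileyT, baileyDelta, bD0, bS0] | 5 => simp [baileyT, baileyDelta, bD0, bS0]
  | 6 => simp [baileyT, baileyDelta, bD0, bS0] | 7 => simp [baileyT, bD0, bS0]
  | n + 8 => simp [baileyT, bD0, bS0]

/-- The `d`-values of the four instance points: `−1, −1, 0, 0`. -/
theorem dOf_four : dOf bD1 = -1 ∧ dOf bS1 = -1 ∧ dOf bD0 = 0 ∧ dOf bS0 = 0 := by
  refine ⟨?_, ?_, ?_, ?_⟩ <;> (simp only [dOf, sum_range_succ, sum_range_zero]; norm_num [bD1, bS1, bD0, bS0])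

/-- The four instance points lie in the box `0 ≤ 2b_j ≤ b₀`. -/
theorem inBox_four : InBox bD1 ∧ InBox bS1 ∧ InBox bD0 ∧ InBox bS0 := by
  refine ⟨⟨by decide, fun j hj => ?_⟩, ⟨by decide, fun j hj => ?_⟩, ⟨by decide, fun j hj => ?_⟩,
    ⟨by decide, fun j hj => ?_⟩⟩ <;>
  · simp only [mem_range] at hj
    interval_cases j <;> simp [bD1, bS1, bD0, bS0]

/-! ### Explicit partial-fraction tables -/

/-- `R_{(2;1⁷)}(t) = (2t+4)(t+1)(t+3)/(t+2)⁶ = 2/(t+2)³ − 2/(t+2)⁵`. -/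
def cD1 : ℕ → ℕ → ℚ := fun o p => if o = 2 ∧ p = 1 then 2 else if o = 4 ∧ p = 1 then -2 else 0
/-- `R_{(1;1⁴,0³)}(t) = (2t+3)/((t+1)(t+2))² = 1/(t+1)² − 1/(t+2)²`. -/
def cS1 : ℕ → ℕ → ℚ := fun o p => if o = 1 ∧ p = 0 then 1 else if o = 1 ∧ p = 1 then -1 else 0
/-- `R_{(2;1⁶,0)}(t) = (2t+4)/(t+2)⁶ = 2/(t+2)⁵`. -/
def cD0 : ℕ → ℕ → ℚ := fun o p => if o = 4 ∧ p = 1 then 2 else 0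
/-- `R_{(1;1³,0⁴)}(t) = (2t+3)/((t+1)(t+2))³ = 1/(t+1)³ − 1/(t+1)² + 1/(t+2)² + 1/(t+2)³`. -/
def cS0 : ℕ → ℕ → ℚ := fun o p =>
  if o = 2 ∧ p = 0 then 1 else if o = 1 ∧ p = 0 then -1 else if o = 1 ∧ p = 1 then 1 else
  if o = 2 ∧ p = 1 then 1 else 0

/-- `(t+1)_2 = (t+1)(t+2)`. -/
theorem poch_two (t : ℚ) : BallRivoal.poch (t + 1) 2 = (t + 1) * (t + 2) := by
  simp only [BallRivoal.poch, prod_range_succ, prod_range_zero]; push_cast; ring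

/-- `(t+1)_3 = (t+1)(t+2)(t+3)`. -/
theorem poch_three (t : ℚ) : BallRivoal.poch (t + 1) 3 = (t + 1) * (t + 2) * (t + 3) := by
  simp only [BallRivoal.poch, prod_range_succ, prod_range_zero]; push_cast; ring

/-- Evaluation of the numerator polynomial at `bD1`. -/
theorem eval_numPoly_bD1 (t : ℚ) :
    ((numPoly bD1).comp (X + C 1)).eval t = (2 * t + 4) * ((t + 1) * (t + 3)) ^ 7 := by
  rw [eval_comp, eval_add, eval_X, eval_C, eval_numPoly]
  have h0 : bD1 0 = 2 := rfl
  have h1 : ∀ j ∈ range 7, bD1 (j + 1) = 1 := fun j hj => by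
    have : j + 1 ≤ 7 := by simp only [mem_range] at hj; omega
    simp [bD1, this]
  rw [prod_congr rfl (fun j hj => by rw [h1 j hj]), prod_const, card_range, h0]
  simp [BallRivoal.poch]
  ring

/-- Evaluation of the numerator polynomial at `bS1`. -/
theorem eval_numPoly_bS1 (t : ℚ) :
    ((numPoly bS1).comp (X + C 1)).eval t = (2 * t + 3) * ((t + 1) * (t + 2)) ^ 4 := by
  rw [eval_comp, eval_add, eval_X, eval_C, eval_numPoly]
  have h0 : bS1 0 = 1 := rfl
  have h1 : ∀ j ∈ range 4, bS1 (j + 1) = 1 := fun j hj => by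
    have : j + 1 ≤ 4 := by simp only [mem_range] at hj; omega
    simp [bS1, this]
  have h2 : bS1 (4 + 1) = 0 ∧ bS1 (5 + 1) = 0 ∧ bS1 (6 + 1) = 0 := by simp [bS1]
  rw [show (7 : ℕ) = 4 + 1 + 1 + 1 from rfl, prod_range_succ, prod_range_succ, prod_range_succ,
    prod_congr rfl (fun j hj => by rw [h1 j hj]), prod_const, card_range, h0, h2.1, h2.2.1, h2.2.2]
  simp [BallRivoal.poch]
  ring

/-- Evaluation of the numerator polynomial at `bD0`. -/
theorem eval_numPoly_bD0 (t : ℚ) :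
    ((numPoly bD0).comp (X + C 1)).eval t = (2 * t + 4) * ((t + 1) * (t + 3)) ^ 6 := by
  rw [eval_comp, eval_add, eval_X, eval_C, eval_numPoly]
  have h0 : bD0 0 = 2 := rfl
  have h1 : ∀ j ∈ range 6, bD0 (j + 1) = 1 := fun j hj => by
    have : j + 1 ≤ 6 := by simp only [mem_range] at hj; omega
    simp [bD0, this]
  have h2 : bD0 (6 + 1) = 0 := by simp [bD0]
  rw [show (7 : ℕ) = 6 + 1 from rfl, prod_range_succ, prod_congr rfl (fun j hj => by rw [h1 j hj]), prod_const,
    card_range, h0, h2]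
  simp [BallRivoal.poch]
  ring

/-- Evaluation of the numerator polynomial at `bS0`. -/
theorem eval_numPoly_bS0 (t : ℚ) :
    ((numPoly bS0).comp (X + C 1)).eval t = (2 * t + 3) * ((t + 1) * (t + 2)) ^ 3 := by
  rw [eval_comp, eval_add, eval_X, eval_C, eval_numPoly]
  have h0 : bS0 0 = 1 := rfl
  have h1 : ∀ j ∈ range 3, bS0 (j + 1) = 1 := fun j hj => by
    have : j + 1 ≤ 3 := by simp only [mem_range] at hj; omega
    simp [bS0, this]
  have h2 : bS0 (3 + 1) = 0 ∧ bS0 (4 + 1) = 0 ∧ bS0 (5 + 1) = 0 ∧ bS0 (6 + 1) = 0 := by simp [bS0]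
  rw [show (7 : ℕ) = 3 + 1 + 1 + 1 + 1 from rfl, prod_range_succ, prod_range_succ, prod_range_succ, prod_range_succ,
    prod_congr rfl (fun j hj => by rw [h1 j hj]), prod_const, card_range, h0, h2.1, h2.2.1, h2.2.2.1, h2.2.2.2]
  simp [BallRivoal.poch]
  ring

/-- The explicit partial-fraction table `cD1` is the partial-fraction data of `bD1`. -/
theorem isPFData_bD1 : IsPFData bD1 cD1 := by
  intro t ht
  have hB : (bD1 0).toNat = 2 := by decide
  rw [hB] at ht ⊢
  have h1 : t + 1 ≠ 0 := by have := ht 0 (by norm_num); simpa using this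
  have h2 : t + 2 ≠ 0 := by have := ht 1 (by norm_num); intro h; apply this; push_cast; linarith
  have h3 : t + 3 ≠ 0 := by have := ht 2 (by norm_num); intro h; apply this; push_cast; linarith
  rw [eval_numPoly_bD1, poch_three]
  simp only [pfEval, sum_range_succ, sum_range_zero, cD1]
  norm_num
  rw [show t + 1 + 1 = t + 2 by ring]
  field_simp
  ring

/-- The explicit partial-fraction table `cS1` is the partial-fraction data of `bS1`. -/
theorem isPFData_bS1 : IsPFData bS1 cS1 := by
  intro t ht
  have hB : (bS1 0).toNat = 1 := by decide
  rw [hB] at ht ⊢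
  have h1 : t + 1 ≠ 0 := by have := ht 0 (by norm_num); simpa using this
  have h2 : t + 2 ≠ 0 := by have := ht 1 (by norm_num); intro h; apply this; push_cast; linarith
  rw [eval_numPoly_bS1, poch_two]
  simp only [pfEval, sum_range_succ, sum_range_zero, cS1]
  norm_num
  rw [show t + 1 + 1 = t + 2 by ring]
  field_simp
  ring

/-- The explicit partial-fraction table `cD0` is the partial-fraction data of `bD0`. -/
theorem isPFData_bD0 : IsPFData bD0 cD0 := by
  intro t ht
  have hB : (bD0 0).toNat = 2 := by decide
  rw [hB] at ht ⊢
  have h1 : t + 1 ≠ 0 := by have := ht 0 (by norm_num); simpa using this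
  have h2 : t + 2 ≠ 0 := by have := ht 1 (by norm_num); intro h; apply this; push_cast; linarith
  have h3 : t + 3 ≠ 0 := by have := ht 2 (by norm_num); intro h; apply this; push_cast; linarith
  rw [eval_numPoly_bD0, poch_three]
  simp only [pfEval, sum_range_succ, sum_range_zero, cD0]
  norm_num
  rw [show t + 1 + 1 = t + 2 by ring]
  field_simp
  ring

/-- The explicit partial-fraction table `cS0` is the partial-fraction data of `bS0`. -/
theorem isPFData_bS0 : IsPFData bS0 cS0 := by
  intro t ht
  have hB : (bS0 0).toNat = 1 := by decide
  rw [hB] at ht ⊢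
  have h1 : t + 1 ≠ 0 := by have := ht 0 (by norm_num); simpa using this
  have h2 : t + 2 ≠ 0 := by have := ht 1 (by norm_num); intro h; apply this; push_cast; linarith
  rw [eval_numPoly_bS0, poch_two]
  simp only [pfEval, sum_range_succ, sum_range_zero, cS0]
  norm_num
  rw [show t + 1 + 1 = t + 2 by ring]
  field_simp
  ring

/-! ### Kernel instances of the deep ↦ shallow law -/

/-- `d = −1`, deep point: `(U,W,V)(2;1⁷) = (−2, 2, 0)`, i.e. `F̃₇(2;1⁷) = 2ζ(3) − 2ζ(5)`. -/
theorem values_bD1 : coeffU bD1 = -2 ∧ coeffW bD1 = 2 ∧ coeffV bD1 = 0 := by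
  have hB : (bD1 0).toNat = 2 := by decide
  rw [coeffU_eq isPFData_bD1, coeffW_eq isPFData_bD1, coeffV_eq isPFData_bD1, hB]
  simp only [sum_range_succ, sum_range_zero, cD1, harm]
  norm_num

/-- `d = −1`, its Bailey image: `(U,W,V)(1;1⁴,0³) = (0, 0, −1)`, i.e. `F̃₇ = 1 ∈ ℚ`. -/
theorem values_bS1 : coeffU bS1 = 0 ∧ coeffW bS1 = 0 ∧ coeffV bS1 = -1 := by
  have hB : (bS1 0).toNat = 1 := by decide
  rw [coeffU_eq isPFData_bS1, coeffW_eq isPFData_bS1, coeffV_eq isPFData_bS1, hB]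
  simp only [sum_range_succ, sum_range_zero, cS1, harm]
  norm_num

/-- `d = 0`, deep point: `(U,W,V)(2;1⁶,0) = (2, 0, 2)`, i.e. `F̃₇ = 2ζ(5) − 2`. -/
theorem values_bD0 : coeffU bD0 = 2 ∧ coeffW bD0 = 0 ∧ coeffV bD0 = 2 := by
  have hB : (bD0 0).toNat = 2 := by decide
  rw [coeffU_eq isPFData_bD0, coeffW_eq isPFData_bD0, coeffV_eq isPFData_bD0, hB]
  simp only [sum_range_succ, sum_range_zero, cD0, harm]
  norm_num

/-- `d = 0`, its Bailey image: `(U,W,V)(1;1³,0⁴) = (0, 2, 2)`, i.e. `F̃₇ = 2ζ(3) − 2` (no `ζ(5)`). -/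
theorem values_bS0 : coeffU bS0 = 0 ∧ coeffW bS0 = 2 ∧ coeffV bS0 = 2 := by
  have hB : (bS0 0).toNat = 1 := by decide
  rw [coeffU_eq isPFData_bS0, coeffW_eq isPFData_bS0, coeffV_eq isPFData_bS0, hB]
  simp only [sum_range_succ, sum_range_zero, cS0, harm]
  norm_num

/-- The two smallest instances of the law, stated through the maps: a Bailey reflection sends the
`ζ(5)`-carrying points `(2;1⁷)` (`d = −1`) and `(2;1⁶,0)` (`d = 0`) to points WITHOUT `ζ(5)`
(and without `ζ(3)` on the balanced slice). -/
theorem baileyShallow_instances :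
    (coeffU bD1 ≠ 0 ∧ coeffU (baileyT 5 6 7 bD1) = 0 ∧ coeffW (baileyT 5 6 7 bD1) = 0) ∧
    (coeffU bD0 ≠ 0 ∧ coeffU (baileyT 4 5 6 bD0) = 0 ∧ coeffW (baileyT 4 5 6 bD0) ≠ 0) := by
  rw [baileyT_bD1, baileyT_bD0, values_bD1.1, values_bS1.1, values_bS1.2.1, values_bD0.1, values_bS0.1,
    values_bS0.2.1]
  norm_num

/-! ### The law (conjecture; exhaustively verified for `b₀ ≤ 30` outside Lean) -/

/-- **Deep ↦ shallow law for the Bailey maps** (OURS, OBSERVED-EXACT: every case with `b₀ ≤ 30` — 1,309 points,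
45,208 images — checked by two independent exact implementations; FAMILY.md §3.4).  For `b` in the Brown–Zudilin
polytope `0 ≤ 2b_l ≤ b₀` on the slices `d(b) ∈ {−1, 0}` and a Bailey map `T_S` (`S = {i<j<k} ⊂ {1..7}`) with `Δ_S(b) ≠ 0` and non-negative image,
the image carries no `ζ(5)`: `U(T_S b) = 0`; on Bailey's balanced slice `d = −1` it is even rational: `W(T_S b) = 0`. -/
@[conjecture] def BaileyShallowLaw : Prop :=
  ∀ (b : ℕ → ℤ) (i j k : ℕ), 0 ≤ b 0 → (∀ l ∈ range 7, 0 ≤ b (l + 1) ∧ 2 * b (l + 1) ≤ b 0) →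
    1 ≤ i → i < j → j < k → k ≤ 7 → (dOf b = -1 ∨ dOf b = 0) → baileyDelta i j k b ≠ 0 →
    (∀ l, 0 ≤ baileyT i j k b l) →
      coeffU (baileyT i j k b) = 0 ∧ (dOf b = -1 → coeffW (baileyT i j k b) = 0)

/-- The law holds at the two kernel instances above (sanity: the conjecture is not vacuous there). -/
theorem baileyShallowLaw_instances :
    (coeffU (baileyT 5 6 7 bD1) = 0 ∧ (dOf bD1 = -1 → coeffW (baileyT 5 6 7 bD1) = 0)) ∧
    (coeffU (baileyT 4 5 6 bD0) = 0 ∧ (dOf bD0 = -1 → coeffW (baileyT 4 5 6 bD0) = 0)) := by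
  refine ⟨⟨?_, fun _ => ?_⟩, ⟨?_, fun h => ?_⟩⟩
  · rw [baileyT_bD1]; exact values_bS1.1
  · rw [baileyT_bD1]; exact values_bS1.2.1
  · rw [baileyT_bD0]; exact values_bS0.1
  · exact absurd h (by rw [dOf_four.2.2.1]; norm_num)

end Summit.KontsevichZagierPeriods.Zeta5Search.RVBailey
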